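import Literature.MathematicalPhysics.QuantumLattice.FermionLiebRobinson
import Literature.MathematicalPhysics.QuantumLattice.HubbardHighTemperatureTwoPoint
import HarnessLib

/-!
# Volume-independent bounds on `‖[H(t,U) - μN, A]‖` for local fermionic observables

Topic `MathematicalPhysics/QuantumLattice`; programme under the tree's fact `bgm_two_point_limit`
(`HubbardFermiLiquid.lean`): the Lipschitz constant of the time dependence of the two-time
correlations `⟨A(τ)B⟩_β` is `‖[H, A]‖ ‖B‖` (`HubbardSchwingerFunctionBound.lean`), so equicontinuity
in the imaginary time of BGM's Schwinger functions `S^{β,L}` (Ann. Henri Poincaré 7 (2006) 809,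
§1.2) uniformly in the volume `L` reduces to a volume-independent bound on the commutator of the
grand-canonical Hubbard Hamiltonian with a single fermion operator. This file proves it from the
local decomposition `H(t,U) - μN = Σ_Z h_Z` of `FermionLiebRobinson.lean` (`hubbardTermOp`: even,
Hermitian, `‖h_Z‖ ≤ 2|t| + |U| + 2|μ|`, at most `|W|(2Δ+1)` terms meeting a set `W` of sites on a
graph of maximal degree `≤ Δ`) and graded locality (even elements of the CAR algebra of a region
commute with the CAR algebra of a disjoint region, Bratteli–Robinson II §5.2.2,
`commute_of_mem_carEvenSubalgebra`). Everything is PROVED; no definition: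

* `norm_commutator_hamiltonianWith_le` — for `A ∈ 𝔄(orbSet W)`:
  `‖[H(t,U) - μN, A]‖ ≤ |W| (2Δ+1) · 2(2|t| + |U| + 2|μ|) ‖A‖`;
* `norm_commutator_hamiltonianWith_annihilation_le`, `_creation_le` — `‖[H, c^{(†)}_{xσ}]‖ ≤
  (2Δ+1) · 2(2|t| + |U| + 2|μ|)`;
* `norm_commutator_hubbardTorusWith_annihilation_le`, `_creation_le` — on the 2D torus `(ℤ/Lℤ)²`
  (degree `≤ 4`, `SourceGas.card_filter_fermionTorusGraph_adj_le`, hopping `t = 1`):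
  `‖[H(1,U) - μN, c^{(†)}_{x̄σ}]‖ ≤ 18 (2 + |U| + 2|μ|)` for EVERY `L`.

## References

* M. B. Hastings, T. Koma, CMP 265 (2006) 781–804, Appendix A (the local-term decomposition and
  the setting of the fermionic Lieb–Robinson bound), as formalised in `FermionLiebRobinson.lean`.
  [HastingsKoma2006]
* O. Bratteli, D. W. Robinson, *Operator Algebras and Quantum Statistical Mechanics II*, 2nd ed.
  (Springer 1997), §5.2.2 (graded commutation in the CAR algebra). [BratteliRobinsonII1997]
* G. Benfatto, A. Giuliani, V. Mastropietro, Ann. Henri Poincaré 7 (2006) 809–898, §1.2.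
  [BenfattoGiulianiMastropietro2006]
-/

noncomputable section

open Matrix Finset
open scoped Matrix.Norms.L2Operator

namespace Literature.MathematicalPhysics.QuantumLattice

section CommutatorBound

variable {Λ : Type*} [LinearOrder Λ] [Fintype Λ] (G : SimpleGraph Λ) [DecidableRel G.Adj]

/-- **The commutator of the Hubbard Hamiltonian with a local fermionic operator is bounded
independently of the volume**: on a graph of maximal degree `≤ Δ`, for `A` in the CAR algebra of
the sites `W`, `‖[H(t,U) - μN, A]‖ ≤ |W| (2Δ+1) · 2(2|t| + |U| + 2|μ|) ‖A‖` — only the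
`≤ |W|(2Δ+1)` local terms of `H` meeting `W` fail to commute with `A` (even terms of the CAR
algebra of a region commute with everything localised in a disjoint region, Bratteli–Robinson II
§5.2.2), each of norm `≤ 2|t| + |U| + 2|μ|`. Hastings–Koma 2006 App. A (the setting of the
fermionic Lieb–Robinson bound). [folklore] -/
theorem norm_commutator_hamiltonianWith_le {Δ : ℕ}
    (hΔ : ∀ x : Λ, (Finset.univ.filter fun y => G.Adj x y).card ≤ Δ) (t U μ : ℝ) {W : Finset Λ}
    {A : Matrix (Finset (Orb Λ)) (Finset (Orb Λ)) ℂ} (hA : A ∈ carSubalgebra (orbSet W)) :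
    ‖hamiltonianWith G t U μ * A - A * hamiltonianWith G t U μ‖ ≤
      (W.card * (2 * Δ + 1) : ℕ) * (2 * (2 * |t| + |U| + 2 * |μ|) * ‖A‖) := by
  classical
  rw [← sum_hubbardTermOp G t U μ, finset_sum_commutator]
  -- only the terms meeting `W` survive
  have hvanish : ∀ Z, Disjoint (hubbardTermSupp G Z) W →
      hubbardTermOp G t U μ Z * A - A * hubbardTermOp G t U μ Z = 0 := fun Z hZ =>
    sub_eq_zero.mpr (commute_of_mem_carEvenSubalgebra (hubbardTermOp_mem_carEvenSubalgebra G t U μ Z) hA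
      (disjoint_orbSet hZ)).eq
  rw [← Finset.sum_filter_of_ne (p := fun Z => ¬ Disjoint (hubbardTermSupp G Z) W)
    (fun Z _ hne hdis => hne (hvanish Z hdis))]
  have hterm : ∀ Z, ‖hubbardTermOp G t U μ Z * A - A * hubbardTermOp G t U μ Z‖ ≤
      2 * (2 * |t| + |U| + 2 * |μ|) * ‖A‖ := fun Z => by
    have hZ := norm_hubbardTermOp_le G t U μ Z
    calc ‖hubbardTermOp G t U μ Z * A - A * hubbardTermOp G t U μ Z‖
        ≤ ‖hubbardTermOp G t U μ Z * A‖ + ‖A * hubbardTermOp G t U μ Z‖ := norm_sub_le _ _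
      _ ≤ ‖hubbardTermOp G t U μ Z‖ * ‖A‖ + ‖A‖ * ‖hubbardTermOp G t U μ Z‖ :=
          add_le_add (norm_mul_le _ _) (norm_mul_le _ _)
      _ = 2 * ‖hubbardTermOp G t U μ Z‖ * ‖A‖ := by ring
      _ ≤ 2 * (2 * |t| + |U| + 2 * |μ|) * ‖A‖ := by gcongr
  calc ‖∑ Z ∈ Finset.univ.filter (fun Z => ¬ Disjoint (hubbardTermSupp G Z) W),
          (hubbardTermOp G t U μ Z * A - A * hubbardTermOp G t U μ Z)‖
      ≤ ∑ Z ∈ Finset.univ.filter (fun Z => ¬ Disjoint (hubbardTermSupp G Z) W),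
          ‖hubbardTermOp G t U μ Z * A - A * hubbardTermOp G t U μ Z‖ := norm_sum_le _ _
    _ ≤ ∑ _Z ∈ Finset.univ.filter (fun Z => ¬ Disjoint (hubbardTermSupp G Z) W),
          2 * (2 * |t| + |U| + 2 * |μ|) * ‖A‖ := Finset.sum_le_sum fun Z _ => hterm Z
    _ = (Finset.univ.filter (fun Z => ¬ Disjoint (hubbardTermSupp G Z) W)).card *
          (2 * (2 * |t| + |U| + 2 * |μ|) * ‖A‖) := by rw [Finset.sum_const, nsmul_eq_mul]
    _ ≤ (W.card * (2 * Δ + 1) : ℕ) * (2 * (2 * |t| + |U| + 2 * |μ|) * ‖A‖) := by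
          have hc := card_filter_not_disjoint_hubbardTermSupp_le G hΔ W
          have hnn : 0 ≤ 2 * (2 * |t| + |U| + 2 * |μ|) * ‖A‖ := by positivity
          exact mul_le_mul_of_nonneg_right (by exact_mod_cast hc) hnn

/-- **`‖[H(t,U) - μN, c_{xσ}]‖ ≤ 2(2Δ+1)(2|t| + |U| + 2|μ|)`**, uniformly in the volume. [folklore] -/
theorem norm_commutator_hamiltonianWith_annihilation_le {Δ : ℕ}
    (hΔ : ∀ x : Λ, (Finset.univ.filter fun y => G.Adj x y).card ≤ Δ) (t U μ : ℝ) (x : Λ) (σ : Fin 2) :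
    ‖hamiltonianWith G t U μ * annihilation (orb x σ) - annihilation (orb x σ) * hamiltonianWith G t U μ‖ ≤
      (2 * Δ + 1 : ℕ) * (2 * (2 * |t| + |U| + 2 * |μ|)) := by
  have hA : (annihilation (orb x σ) : Matrix (Finset (Orb Λ)) (Finset (Orb Λ)) ℂ) ∈
      carSubalgebra (orbSet ({x} : Finset Λ)) :=
    annihilation_mem_carSubalgebra (orb_mem_orbSet (Finset.mem_singleton_self x) σ)
  have h := norm_commutator_hamiltonianWith_le G hΔ t U μ hA
  rw [Finset.card_singleton, one_mul] at h
  refine h.trans ?_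
  have hJ : 0 ≤ 2 * (2 * |t| + |U| + 2 * |μ|) := by positivity
  have hc := norm_annihilation_le_one (ι := Orb Λ) (orb x σ)
  calc ((2 * Δ + 1 : ℕ) : ℝ) * (2 * (2 * |t| + |U| + 2 * |μ|) * ‖(annihilation (orb x σ) :
          Matrix (Finset (Orb Λ)) (Finset (Orb Λ)) ℂ)‖)
      ≤ ((2 * Δ + 1 : ℕ) : ℝ) * (2 * (2 * |t| + |U| + 2 * |μ|) * 1) := by gcongr
    _ = _ := by rw [mul_one]

/-- **`‖[H(t,U) - μN, c†_{xσ}]‖ ≤ 2(2Δ+1)(2|t| + |U| + 2|μ|)`**, uniformly in the volume. [folklore] -/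
theorem norm_commutator_hamiltonianWith_creation_le {Δ : ℕ}
    (hΔ : ∀ x : Λ, (Finset.univ.filter fun y => G.Adj x y).card ≤ Δ) (t U μ : ℝ) (x : Λ) (σ : Fin 2) :
    ‖hamiltonianWith G t U μ * creation (orb x σ) - creation (orb x σ) * hamiltonianWith G t U μ‖ ≤
      (2 * Δ + 1 : ℕ) * (2 * (2 * |t| + |U| + 2 * |μ|)) := by
  have hA : (creation (orb x σ) : Matrix (Finset (Orb Λ)) (Finset (Orb Λ)) ℂ) ∈
      carSubalgebra (orbSet ({x} : Finset Λ)) :=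
    creation_mem_carSubalgebra (orb_mem_orbSet (Finset.mem_singleton_self x) σ)
  have h := norm_commutator_hamiltonianWith_le G hΔ t U μ hA
  rw [Finset.card_singleton, one_mul] at h
  refine h.trans ?_
  have hJ : 0 ≤ 2 * (2 * |t| + |U| + 2 * |μ|) := by positivity
  have hc := norm_creation_le_one (ι := Orb Λ) (orb x σ)
  calc ((2 * Δ + 1 : ℕ) : ℝ) * (2 * (2 * |t| + |U| + 2 * |μ|) * ‖(creation (orb x σ) :
          Matrix (Finset (Orb Λ)) (Finset (Orb Λ)) ℂ)‖)
      ≤ ((2 * Δ + 1 : ℕ) : ℝ) * (2 * (2 * |t| + |U| + 2 * |μ|) * 1) := by gcongr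
    _ = _ := by rw [mul_one]

end CommutatorBound

section Torus

open Literature.Probability.LatticeModels

/-- **On the 2D torus `‖[H(1,U) - μN, c_{x̄σ}]‖ ≤ 18 (2 + |U| + 2|μ|)` for every `L`** (degree `≤ 4`,
hopping `t = 1`). [folklore] -/
theorem norm_commutator_hubbardTorusWith_annihilation_le (U μ : ℝ) (L : ℕ) [NeZero L]
    (v : FermionTorus 2 L) (σ : Fin 2) :
    ‖hubbardTorusWith 2 L 1 U μ * annihilation (orb v σ) - annihilation (orb v σ) * hubbardTorusWith 2 L 1 U μ‖ ≤
      18 * (2 + |U| + 2 * |μ|) := by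
  have h := norm_commutator_hamiltonianWith_annihilation_le (fermionTorusGraph 2 L)
    (Δ := 4) (fun x => SourceGas.card_filter_fermionTorusGraph_adj_le x) 1 U μ v σ
  rw [hubbardTorusWith]
  refine h.trans (le_of_eq ?_)
  norm_num
  ring

/-- The same for `c†_{x̄σ}`. [folklore] -/
theorem norm_commutator_hubbardTorusWith_creation_le (U μ : ℝ) (L : ℕ) [NeZero L]
    (v : FermionTorus 2 L) (σ : Fin 2) :
    ‖hubbardTorusWith 2 L 1 U μ * creation (orb v σ) - creation (orb v σ) * hubbardTorusWith 2 L 1 U μ‖ ≤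
      18 * (2 + |U| + 2 * |μ|) := by
  have h := norm_commutator_hamiltonianWith_creation_le (fermionTorusGraph 2 L)
    (Δ := 4) (fun x => SourceGas.card_filter_fermionTorusGraph_adj_le x) 1 U μ v σ
  rw [hubbardTorusWith]
  refine h.trans (le_of_eq ?_)
  norm_num
  ring

end Torus

end Literature.MathematicalPhysics.QuantumLattice
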